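import Mathlib
import HarnessLib

/-!
# LatticeQCDFlow / Scaling — a probability measure on `ℝ` that is not a point mass charges `{s < t}`

HONEST FRAMING: exact (Metropolis-corrected) sampling algorithms for lattice gauge theory;
figures of merit are autocorrelation/cost numbers at stated couplings and volumes; no
continuum-physics claim.

Venture `LatticeQCDFlow` (cell pub-lqcd), topic `Scaling`, FANOUT row 30 (lean-1, GEN-17) — OUR WORK,
bookkeeping for the strict-total-positivity chain (`KernelCompositionTP2`, `KernelMarginalSMTP2`, …):
those files carry the hypothesis `0 < (μ ⊗ μ){p | p.1 < p.2}` ("the reference measure is not a point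
mass"); `KernelCompositionTP2.real_prod_lt_pos` derives it from two charged half-lines.  Here the
canonical form on `ℝ`:

* `real_prod_lt_eq_zero_of_dirac` — a point mass gives `(δ_x ⊗ δ_x){p | p.1 < p.2} = 0`;
* **`real_prod_lt_pos_of_ne_dirac`** — for a probability measure `ν` on `ℝ` with `ν ≠ δ_x` for every
  `x`, `0 < (ν ⊗ ν){p | p.1 < p.2}` (otherwise every threshold `c` has `ν(−∞,c) = 0` or `ν(c,∞) = 0`,
  and the infimum `m` of the thresholds with `ν(c,∞) = 0` carries all the mass).

Elementary; nothing is cited as a fact; no `def`; no `sorry`.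
-/

noncomputable section

namespace Summit.Ventures.LatticeQCDFlow.Theory2.Autoregressive

open MeasureTheory Set

/-- For a point mass the strict half-plane `{s < t}` is null. [ours] -/
theorem real_prod_lt_eq_zero_of_dirac (x : ℝ) :
    ((Measure.dirac x).prod (Measure.dirac x)) {p : ℝ × ℝ | p.1 < p.2} = 0 := by
  rw [Measure.dirac_prod_dirac, Measure.dirac_apply' _ (measurableSet_lt measurable_fst measurable_snd)]
  simp

/-- **A PROBABILITY MEASURE ON `ℝ` THAT IS NOT A POINT MASS CHARGES `{s < t}`**: `ν ≠ δ_x` for all `x`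
⇒ `0 < (ν ⊗ ν){p | p.1 < p.2}`. [ours] -/
theorem real_prod_lt_pos_of_ne_dirac (ν : Measure ℝ) [IsProbabilityMeasure ν]
    (hν : ∀ x, ν ≠ Measure.dirac x) : 0 < (ν.prod ν) {p : ℝ × ℝ | p.1 < p.2} := by
  by_contra h0
  have hzero : (ν.prod ν) {p : ℝ × ℝ | p.1 < p.2} = 0 := le_antisymm (not_lt.1 h0) zero_le
  -- every threshold has an empty side
  have hside : ∀ c : ℝ, ν (Iio c) = 0 ∨ ν (Ioi c) = 0 := by
    intro c
    have hsub : Iio c ×ˢ Ioi c ⊆ {p : ℝ × ℝ | p.1 < p.2} := fun p hp =>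
      (lt_trans (mem_Iio.1 hp.1) (mem_Ioi.1 hp.2) : p.1 < p.2)
    have h := measure_mono (μ := ν.prod ν) hsub
    rw [hzero, Measure.prod_prod, nonpos_iff_eq_zero, mul_eq_zero] at h
    exact h
  have huniv : ν univ = 1 := measure_univ
  -- the thresholds with an empty right side
  set T : Set ℝ := {c | ν (Ioi c) = 0} with hT
  have hTup : ∀ c c', c ∈ T → c ≤ c' → c' ∈ T := fun c c' hc hcc =>
    le_antisymm ((measure_mono (Ioi_subset_Ioi hcc)).trans (le_of_eq hc)) zero_le
  have hTne : T.Nonempty := by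
    by_contra hemp
    rw [Set.not_nonempty_iff_eq_empty] at hemp
    have hall : ∀ n : ℕ, ν (Iio (n : ℝ)) = 0 := fun n => by
      rcases hside n with h | h
      · exact h
      · exact absurd (show (n : ℝ) ∈ T from h) (by rw [hemp]; exact fun h => h)
    have hcov : (univ : Set ℝ) ⊆ ⋃ n : ℕ, Iio (n : ℝ) := fun y _ => by
      obtain ⟨n, hn⟩ := exists_nat_gt y
      exact mem_iUnion.2 ⟨n, hn⟩
    have h := measure_mono (μ := ν) hcov
    rw [huniv, measure_iUnion_null hall] at h
    exact absurd h (by simp)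
  have hTbdd : BddBelow T := by
    by_contra hbdd
    have hall : ∀ n : ℕ, ν (Ioi (-(n : ℝ))) = 0 := fun n => by
      by_contra hn
      exact hbdd ⟨-(n : ℝ), fun c hc => le_of_not_gt fun hlt => hn (hTup c _ hc hlt.le)⟩
    have hcov : (univ : Set ℝ) ⊆ ⋃ n : ℕ, Ioi (-(n : ℝ)) := fun y _ => by
      obtain ⟨n, hn⟩ := exists_nat_gt (-y)
      exact mem_iUnion.2 ⟨n, by simp only [mem_Ioi]; linarith⟩
    have h := measure_mono (μ := ν) hcov
    rw [huniv, measure_iUnion_null hall] at h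
    exact absurd h (by simp)
  set m : ℝ := sInf T with hm
  -- nothing above `m`
  have habove : ν (Ioi m) = 0 := by
    have hcov : Ioi m ⊆ ⋃ n : ℕ, Ioi (m + 1 / ((n : ℝ) + 1)) := fun y hy => by
      obtain ⟨n, hn⟩ := exists_nat_one_div_lt (sub_pos.2 (mem_Ioi.1 hy))
      exact mem_iUnion.2 ⟨n, by simp only [mem_Ioi]; linarith⟩
    have hall : ∀ n : ℕ, ν (Ioi (m + 1 / ((n : ℝ) + 1))) = 0 := fun n => by
      have hlt : sInf T < m + 1 / ((n : ℝ) + 1) := by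
        rw [← hm]; have : (0 : ℝ) < 1 / ((n : ℝ) + 1) := by positivity
        linarith
      obtain ⟨t, htT, htlt⟩ := exists_lt_of_csInf_lt hTne hlt
      exact hTup t _ htT htlt.le
    exact le_antisymm ((measure_mono hcov).trans (le_of_eq (measure_iUnion_null hall))) zero_le
  -- nothing below `m`
  have hbelow : ν (Iio m) = 0 := by
    have hcov : Iio m ⊆ ⋃ n : ℕ, Iio (m - 1 / ((n : ℝ) + 1)) := fun y hy => by
      obtain ⟨n, hn⟩ := exists_nat_one_div_lt (sub_pos.2 (mem_Iio.1 hy))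
      exact mem_iUnion.2 ⟨n, by simp only [mem_Iio]; linarith⟩
    have hall : ∀ n : ℕ, ν (Iio (m - 1 / ((n : ℝ) + 1))) = 0 := fun n => by
      have hpos : (0 : ℝ) < 1 / ((n : ℝ) + 1) := by positivity
      have hnotT : m - 1 / ((n : ℝ) + 1) ∉ T := fun hc => by
        have := csInf_le hTbdd hc
        rw [← hm] at this
        linarith
      rcases hside (m - 1 / ((n : ℝ) + 1)) with h | h
      · exact h
      · exact absurd h hnotT
    exact le_antisymm ((measure_mono hcov).trans (le_of_eq (measure_iUnion_null hall))) zero_le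
  -- hence all the mass sits at `m`
  have hcompl : ν {m}ᶜ = 0 := by
    have hcov : ({m}ᶜ : Set ℝ) ⊆ Iio m ∪ Ioi m := fun y hy => by
      rcases lt_or_gt_of_ne (show y ≠ m from hy) with h | h
      · exact Or.inl h
      · exact Or.inr h
    refine le_antisymm ((measure_mono hcov).trans ?_) zero_le
    calc ν (Iio m ∪ Ioi m) ≤ ν (Iio m) + ν (Ioi m) := measure_union_le _ _
      _ = 0 := by rw [habove, hbelow, add_zero]
  refine hν m (Measure.ext fun s hs => ?_)
  rw [Measure.dirac_apply' _ hs]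
  by_cases hms : m ∈ s
  · rw [indicator_of_mem hms, Pi.one_apply]
    have hsub : sᶜ ⊆ ({m} : Set ℝ)ᶜ := fun y hy hym =>
      hy (by rw [mem_singleton_iff.1 hym]; exact hms)
    have hsc : ν sᶜ = 0 :=
      le_antisymm ((measure_mono hsub).trans (le_of_eq hcompl)) zero_le
    have h := measure_add_measure_compl (μ := ν) hs
    rw [hsc, add_zero, huniv] at h
    exact h
  · rw [indicator_of_notMem hms]
    have hsub : s ⊆ ({m} : Set ℝ)ᶜ := fun y hy hym =>
      hms (by rw [← mem_singleton_iff.1 hym]; exact hy)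
    exact le_antisymm ((measure_mono hsub).trans (le_of_eq hcompl)) zero_le

end Summit.Ventures.LatticeQCDFlow.Theory2.Autoregressive

end
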